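import Summits.BirchSwinnertonDyer.BirchSwinnertonDyer.Theses.KolyvaginRankRigidityAtTwo
import Summits.BirchSwinnertonDyer.BirchSwinnertonDyer.Theses.GenusKolyvaginAtTwo
import Summits.BirchSwinnertonDyer.BirchSwinnertonDyer.Theorems.KolyvaginRankRigidityAtTwoSwapTwoTermReciprocity
import Summits.BirchSwinnertonDyer.BirchSwinnertonDyer.Theorems.ClassRecordThreeEulerHalvesAtThreeWalkSupplyTransverse
import Summits.BirchSwinnertonDyer.BirchSwinnertonDyer.Theorems.ClassRecordThreeEulerHalvesAtThreeWalkSupplySelmer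
import Literature.NumberTheory.EllipticCurves.HeegnerPointsOfConductor
import HarnessLib

/-!
# Crux V2♭θ / V2♭∞ (stmt-BirchSwinnertonDyer-27220; line `kolyvagin_depth_split`), stub S1 — the prime
# swap at 2 from its pieces, I: preliminaries

Arithmetic / transport helpers, the local dictionaries at level `2^M` (`ker loc_v = torsionLocalKer`,
Kummer kernel = preimage of the Kummer condition), `2^t · c_M(n) ∈ H¹_{𝓕(n)}` (T2 + P4 + complex places),
`KolyvaginRelationAtTwo` through a cast of the conductor, and the place bookkeeping of the swap
`n ↦ n / a · ℓ`. Consumed by `…SwapFromPiecesCore` / `…SwapFromPieces`. HONEST FRAMING: plumbing only;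
P4 and Q2 enter as hypotheses; nothing here proves S1, V2♭θ or BSD.
-/

set_option autoImplicit false
set_option linter.dupNamespace false

noncomputable section

open scoped Classical Pointwise
open Function NumberField IsDedekindDomain WeierstrassCurve Field
open Literature.NumberTheory.EllipticCurves Literature.NumberTheory.GaloisRepresentations
open Literature.NumberTheory.EllipticCurves.Jetchev2008 Literature.NumberTheory.EllipticCurves.ModularForms
open Literature.NumberTheory.GaloisCohomology
open Literature.NumberTheory.GaloisRepresentations.DiscreteGaloisModule (localTatePairingZMod
  tateDual SelmerStructure)
open Summit.BirchSwinnertonDyer.Rank1Residual.JET.SelmerVocabulary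
open Summit.BirchSwinnertonDyer.Rank1Residual.JET.GlobalDuality
open Summit.BirchSwinnertonDyer.BirchSwinnertonDyer.Theses.KolyvaginRankRigidityAtTwo
open Summit.BirchSwinnertonDyer.BirchSwinnertonDyer.Theses.GenusKolyvaginAtTwo (KolyvaginRelationAtTwo)

namespace Summit.BirchSwinnertonDyer.BirchSwinnertonDyer.Theorems.KolyvaginLowerBoundAtTwo

/-! ### Arithmetic and transport helpers -/

/-- Transport of a datum along an equality of conductors keeps its classes. [folklore] -/
theorem kolyvaginClass_cast_swap {W : WeierstrassCurve ℚ} [W.IsGloballyMinimal] {K : Type}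
    [Field K] [NumberField K] [NeZero (W.conductorNorm ℤ)]
    {Dt : ModularParametrizationData W (W.conductorNorm ℤ)} {β : ℤ} {ι : K →+* ℂ} {n n' : ℕ}
    (h : n = n') (d : KolyvaginHeegnerData Dt β ι n) (M : ℕ) :
    (h ▸ d).kolyvaginClass Nat.prime_two M = d.kolyvaginClass Nat.prime_two M := by
  subst h; rfl

/-- Membership transported along an equality. [folklore] -/
theorem mem_of_eq_of_mem_swap {A : Type*} [AddGroup A] {S : AddSubgroup A} {x y : A} (h : y ∈ S) (e : x = y) :
    x ∈ S := e ▸ h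

/-- Larger powers of `2` still kill. [folklore] -/
theorem two_pow_zsmul_eq_zero_of_le_swap {A : Type*} [AddCommGroup A] {x : A} {a b : ℕ} (hab : a ≤ b)
    (ha : ((2 ^ a : ℕ) : ℤ) • x = 0) : ((2 ^ b : ℕ) : ℤ) • x = 0 := by
  have : ((2 ^ b : ℕ) : ℤ) = ((2 ^ (b - a) : ℕ) : ℤ) * ((2 ^ a : ℕ) : ℤ) := by
    rw [← Nat.cast_mul, ← pow_add, Nat.sub_add_cancel hab]
  rw [this, mul_smul, ha, smul_zero]

/-- Smaller powers of `2` of a non-zero multiple are non-zero. [folklore] -/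
theorem two_pow_zsmul_ne_zero_of_le_swap {A : Type*} [AddCommGroup A] {x : A} {a b : ℕ} (hab : a ≤ b)
    (hb : ((2 ^ b : ℕ) : ℤ) • x ≠ 0) : ((2 ^ a : ℕ) : ℤ) • x ≠ 0 :=
  fun ha ↦ hb (two_pow_zsmul_eq_zero_of_le_swap hab ha)

/-- **The exact order exponent** of a `2^M`-torsion element of order `> 2^r`: a `u` with `r < u ≤ M`,
`2^u x = 0`, `2^(u-1) x ≠ 0`. [folklore] -/
theorem exists_two_pow_orderExp_swap {A : Type*} [AddCommGroup A] (x : A) {M r : ℕ}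
    (hM : ((2 ^ M : ℕ) : ℤ) • x = 0) (hr : ((2 ^ r : ℕ) : ℤ) • x ≠ 0) :
    ∃ u : ℕ, r < u ∧ u ≤ M ∧ ((2 ^ u : ℕ) : ℤ) • x = 0 ∧ ((2 ^ (u - 1) : ℕ) : ℤ) • x ≠ 0 := by
  classical
  have hex : ∃ u : ℕ, ((2 ^ u : ℕ) : ℤ) • x = 0 := ⟨M, hM⟩
  have hru : r < Nat.find hex := by
    by_contra h
    exact hr (two_pow_zsmul_eq_zero_of_le_swap (not_lt.mp h) (Nat.find_spec hex))
  refine ⟨Nat.find hex, hru, Nat.find_min' hex hM, Nat.find_spec hex, ?_⟩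
  exact fun h0 ↦ Nat.find_min hex (Nat.sub_lt (by omega) one_pos) h0


section Frame

variable {K : Type} [Field K] [NumberField K] (W : WeierstrassCurve ℚ) [W.IsElliptic]
  [W.IsGloballyMinimal] [(W.baseChange K).IsElliptic] [NeZero (W.conductorNorm ℤ)]
  (Dt : ModularParametrizationData W (W.conductorNorm ℤ)) (β : ℤ) (ι : K →+* ℂ)
  (𝒯 : ∀ M : ℕ, SelmerStructure ((W.baseChange K).torsionGaloisModule ((2 ^ M : ℕ) : ℤ)))
  (hCM : ¬ W.HasCM) (hsur : ∀ m : ℕ, W.HasSurjectiveModNGaloisRep (2 ^ m : ℕ)) (hK : IsImaginaryQuadratic K)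
  (hne3 : NumberField.discr K ≠ -3) (hne4 : NumberField.discr K ≠ -4)
  (hHN : SatisfiesHeegnerHypothesis (W.conductorNorm ℤ) K)
  (hP4 : ∀ (M c : ℕ) (dat : KolyvaginHeegnerData Dt β ι c),
    KolyvaginDescent.KolSupp (Zhang2014.IsKolyvaginPrime (W.conductorNorm ℤ) W K 2) c → 1 ≤ M →
    (∀ q ∈ c.primeFactors, M + 1 ≤ Zhang2014.kolyvaginIndex W 2 q) →
    ∀ w ∈ placesDividing K c,
      galoisCohomology.localization ((W.baseChange K).torsionGaloisModule ((2 ^ M : ℕ) : ℤ)) (Sum.inr w) 1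
        (dat.kolyvaginClass Nat.prime_two M) ∈ 𝒯 M (Sum.inr w))
  (hQ2 : KolyvaginRelationAtTwo)
  {t : ℕ}
  (hT2 : ∀ (n : ℕ) (d : KolyvaginHeegnerData Dt β ι n) (M : ℕ),
    KolyvaginDescent.KolSupp (Zhang2014.IsKolyvaginPrime (W.conductorNorm ℤ) W K 2) n →
    1 ≤ M → (M : ℕ∞) ≤ Zhang2014.levelIndex W 2 n →
    ∀ v : HeightOneSpectrum (𝓞 K), ((n : ℕ) : 𝓞 K) ∉ v.asIdeal →
      ((2 ^ t : ℕ) : ℤ) • d.kolyvaginClass Nat.prime_two M ∈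
        selmerLocalKer (W.baseChange K) (v.adicCompletion K) ((2 ^ M : ℕ) : ℤ))

/-! ### The places of the swap `n ↦ n / a · ℓ` -/

/-- Place bookkeeping of the swap: for `n` square-free, `a ∣ n` and `ℓ ∤ n` inert primes with places
`v₀ ∣ a`, `v' ∣ ℓ`: `v' ≠ v₀`; `v₀, v' ∤ n / a`; `v₀, v' ∣ n ℓ`; the places of `n / a` divide `n ℓ`; and
every place of `n ℓ` is a place of `n / a` or `v₀` or `v'`. [folklore] -/
theorem swapPlaces {n a ℓ : ℕ} (hn : Squarefree n) (ha : a ∈ n.primeFactors)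
    (hainert : (Ideal.span {((a : ℕ) : 𝓞 K)}).IsPrime) (hℓp : ℓ.Prime)
    (hℓinert : (Ideal.span {((ℓ : ℕ) : 𝓞 K)}).IsPrime) (hℓn : ℓ ∉ n.primeFactors)
    {v₀ v' : HeightOneSpectrum (𝓞 K)} (hv₀ : ((a : ℕ) : 𝓞 K) ∈ v₀.asIdeal)
    (hv' : ((ℓ : ℕ) : 𝓞 K) ∈ v'.asIdeal) :
    v' ≠ v₀ ∧ v₀ ∉ placesDividing K (n / a) ∧ v' ∉ placesDividing K (n / a) ∧
      v₀ ∈ placesDividing K (n * ℓ) ∧ v' ∈ placesDividing K (n * ℓ) ∧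
      (∀ v ∈ placesDividing K (n / a), v ∈ placesDividing K (n * ℓ)) ∧
      (∀ v ∈ placesDividing K (n * ℓ), v ∈ placesDividing K (n / a) ∨ v = v₀ ∨ v = v') := by
  have hn0 : n ≠ 0 := hn.ne_zero
  have hap : a.Prime := Nat.prime_of_mem_primeFactors ha
  have han : a ∣ n := Nat.dvd_of_mem_primeFactors ha
  have hmn : n / a ∣ n := Nat.div_dvd_of_dvd han
  have hm0 : n / a ≠ 0 := (hn.squarefree_of_dvd hmn).ne_zero
  have hmpf : ∀ q ∈ (n / a).primeFactors, q ∈ n.primeFactors :=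
    fun q hq ↦ Nat.primeFactors_mono hmn hn0 hq
  have ham : a ∉ (n / a).primeFactors := by
    intro h
    have hdvd₂ : a * a ∣ n := by
      have := Nat.mul_dvd_mul_left a (Nat.dvd_of_mem_primeFactors h)
      rwa [Nat.mul_div_cancel' han] at this
    exact hap.one_lt.ne' (Nat.isUnit_iff.mp (hn a hdvd₂))
  have hℓ0 : ℓ ≠ 0 := hℓp.ne_zero
  have hℓdvd : ¬ ℓ ∣ n := fun h ↦ hℓn (Nat.mem_primeFactors.mpr ⟨hℓp, h, hn0⟩)
  have hN : Squarefree (n * ℓ) :=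
    (Nat.squarefree_mul ((Nat.Prime.coprime_iff_not_dvd hℓp).mpr hℓdvd).symm).mpr ⟨hn, hℓp.squarefree⟩
  have hN0 : n * ℓ ≠ 0 := hN.ne_zero
  have hNpf : (n * ℓ).primeFactors = n.primeFactors ∪ {ℓ} := by
    rw [Nat.primeFactors_mul hn0 hℓ0, hℓp.primeFactors]
  have hn''eq : n / a * ℓ * a = n * ℓ := by rw [mul_right_comm, Nat.div_mul_cancel han]
  have hv'v₀ : v' ≠ v₀ := by
    rintro rfl
    have := Summit.BirchSwinnertonDyer.Rank1Residual.JET.Walk.prime_eq_of_natCast_mem v' hℓp hap hv' hv₀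
    exact hℓn (this ▸ ha)
  have hv₀m : v₀ ∉ placesDividing K (n / a) := by
    rw [mem_placesDividing_iff_natCast_mem hm0, natCast_mem_iff_exists_primeFactor_mem hm0]
    rintro ⟨q, hq, hqv⟩
    have := Summit.BirchSwinnertonDyer.Rank1Residual.JET.Walk.prime_eq_of_natCast_mem v₀
      (Nat.prime_of_mem_primeFactors hq) hap hqv hv₀
    exact ham (this ▸ hq)
  have hv'm : v' ∉ placesDividing K (n / a) := by
    rw [mem_placesDividing_iff_natCast_mem hm0, natCast_mem_iff_exists_primeFactor_mem hm0]
    rintro ⟨q, hq, hqv⟩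
    have := Summit.BirchSwinnertonDyer.Rank1Residual.JET.Walk.prime_eq_of_natCast_mem v'
      (Nat.prime_of_mem_primeFactors hq) hℓp hqv hv'
    exact hℓn (this ▸ hmpf q hq)
  have hv₀N : v₀ ∈ placesDividing K (n * ℓ) := by
    rw [mem_placesDividing_iff_natCast_mem hN0, ← hn''eq, Nat.cast_mul]
    exact v₀.asIdeal.mul_mem_left _ hv₀
  have hv'N : v' ∈ placesDividing K (n * ℓ) := by
    rw [mem_placesDividing_iff_natCast_mem hN0, Nat.cast_mul]
    exact v'.asIdeal.mul_mem_left _ hv'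
  have hmc : ∀ v ∈ placesDividing K (n / a), v ∈ placesDividing K (n * ℓ) := by
    intro v hv
    rw [mem_placesDividing_iff_natCast_mem hm0] at hv
    rw [mem_placesDividing_iff_natCast_mem hN0]
    obtain ⟨c, hc⟩ := hmn.trans (Dvd.intro ℓ rfl)
    rw [hc, Nat.cast_mul]
    exact v.asIdeal.mul_mem_right _ hv
  have hcov : ∀ v ∈ placesDividing K (n * ℓ), v ∈ placesDividing K (n / a) ∨ v = v₀ ∨ v = v' := by
    intro v hv
    rw [mem_placesDividing_iff_natCast_mem hN0, natCast_mem_iff_exists_primeFactor_mem hN0] at hv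
    obtain ⟨q, hq, hqv⟩ := hv
    rw [hNpf, Finset.mem_union, Finset.mem_singleton] at hq
    rcases hq with hq | rfl
    · by_cases hqa : q = a
      · subst hqa
        exact Or.inr (Or.inl (Summit.BirchSwinnertonDyer.Rank1Residual.JET.Walk.place_eq_of_natCast_mem_of_isPrime
          hap.ne_zero hainert v v₀ hqv hv₀))
      · left
        rw [mem_placesDividing_iff_natCast_mem hm0, natCast_mem_iff_exists_primeFactor_mem hm0]
        refine ⟨q, Nat.mem_primeFactors.mpr ⟨Nat.prime_of_mem_primeFactors hq, ?_, hm0⟩, hqv⟩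
        have hcop : Nat.Coprime q a := (Nat.coprime_primes (Nat.prime_of_mem_primeFactors hq) hap).mpr hqa
        exact (hcop.dvd_mul_right).mp (by rw [Nat.div_mul_cancel han]; exact Nat.dvd_of_mem_primeFactors hq)
    · exact Or.inr (Or.inr (Summit.BirchSwinnertonDyer.Rank1Residual.JET.Walk.place_eq_of_natCast_mem_of_isPrime
        hℓ0 hℓinert v v' hqv hv'))
  exact ⟨hv'v₀, hv₀m, hv'm, hv₀N, hv'N, hmc, hcov⟩


/-! ### Local dictionaries at level `2^M` -/

omit [W.IsElliptic] [W.IsGloballyMinimal] [NeZero (W.conductorNorm ℤ)] in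
/-- `ker(loc_v)` on `H¹(K, E[2^M])` IS `torsionLocalKer`. [folklore] -/
theorem mem_torsionLocalKer_two_pow_iff (M : ℕ) (v : HeightOneSpectrum (𝓞 K))
    (x : galH1Torsion (W.baseChange K) ((2 ^ M : ℕ) : ℤ)) :
    x ∈ (W.baseChange K).torsionLocalKer (v.adicCompletion K) ((2 ^ M : ℕ) : ℤ) ↔
      galoisCohomology.localization ((W.baseChange K).torsionGaloisModule ((2 ^ M : ℕ) : ℤ)) (Sum.inr v) 1 x = 0 := by
  haveI : CharZero (v.adicCompletion K) :=
    charZero_of_injective_algebraMap (algebraMap K (v.adicCompletion K)).injective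
  exact mem_torsionLocalKer_iff_res_eq_zero (W.baseChange K) (v.adicCompletion K) (k := 2 ^ M)
    (pow_ne_zero M two_ne_zero) x

omit [W.IsElliptic] [W.IsGloballyMinimal] [NeZero (W.conductorNorm ℤ)] [(W.baseChange K).IsElliptic] in
/-- The Kummer local kernel IS the preimage of the Kummer local condition. [folklore] -/
theorem mem_selmerLocalKer_two_pow_iff (M : ℕ) (v : HeightOneSpectrum (𝓞 K))
    (x : galH1Torsion (W.baseChange K) ((2 ^ M : ℕ) : ℤ)) :
    x ∈ selmerLocalKer (W.baseChange K) (v.adicCompletion K) ((2 ^ M : ℕ) : ℤ) ↔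
      galoisCohomology.localization ((W.baseChange K).torsionGaloisModule ((2 ^ M : ℕ) : ℤ)) (Sum.inr v) 1 x ∈
        (W.baseChange K).kummerSelmerStructure ((2 ^ M : ℕ) : ℤ) (Sum.inr v) :=
  (SetLike.ext_iff.mp
    ((W.baseChange K).comap_localization_kummerSelmerStructure ((2 ^ M : ℕ) : ℤ) (Sum.inr v)) x).symm

/-! ### `2^t · c_M(n) ∈ H¹_{𝓕(n)}` (T2 + P4 + complex places) -/

include hK hP4 hT2 in
omit [W.IsElliptic] [(W.baseChange K).IsElliptic] in
/-- The Kolyvagin class `2^t · c_M(n)` lies in the Selmer group of `𝓕(n)` (transverse at `λ ∣ n`, Kummer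
elsewhere), for `n` a square-free product of Kolyvagin primes of index `≥ M + 1`.
[cite: McCallumLMS1991, §5 Lemma 5.3, Prop. 4.4] [cite: GrossLMS1991, Prop. 3.7, Prop. 6.2] -/
theorem zsmul_kolyvaginClass_mem_selmerF {M n : ℕ} (d : KolyvaginHeegnerData Dt β ι n)
    (hn : KolyvaginDescent.KolSupp (Zhang2014.IsKolyvaginPrime (W.conductorNorm ℤ) W K 2) n) (hM : 1 ≤ M)
    (hidx : ∀ q ∈ n.primeFactors, M + 1 ≤ Zhang2014.kolyvaginIndex W 2 q) :
    ((2 ^ t : ℕ) : ℤ) • d.kolyvaginClass Nat.prime_two M ∈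
      (selmerF W ((2 ^ M : ℕ) : ℤ) (𝒯 M) (placesDividing K n)).selmerGroup := by
  have hn0 : n ≠ 0 := hn.1.ne_zero
  have hlev : (M : ℕ∞) ≤ Zhang2014.levelIndex W 2 n :=
    Zhang2014.natCast_le_levelIndex_iff.mpr fun q hq ↦ Nat.le_of_succ_le (hidx q hq)
  refine (mem_selmerGroup_selmerF_iff W _ (𝒯 M) hn0 _).mpr ⟨fun v hv ↦ ?_, fun w hw ↦ ?_⟩
  · rcases v with u | v
    · rw [addSubgroup_galoisCohomology_inl_eq_top_of_isComplex _ (hK.2.isComplex u)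
        ((W.baseChange K).kummerSelmerStructure ((2 ^ M : ℕ) : ℤ) (Sum.inl u))]
      trivial
    · have hnv : ((n : ℕ) : 𝓞 K) ∉ v.asIdeal := by
        intro h
        obtain ⟨q, hq, hqv⟩ := (natCast_mem_iff_exists_primeFactor_mem hn0 v).mp h
        exact hv q hq ⟨v, rfl, hqv⟩
      exact (mem_selmerLocalKer_two_pow_iff W M v _).mp (hT2 n d M hn hM hlev v hnv)
  · convert AddSubgroup.zsmul_mem _ (hP4 M n d hn hM hidx w hw) ((2 ^ t : ℕ) : ℤ) using 1
    exact map_zsmul _ _ _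

/-! ### Q2 through a cast of the conductor -/

include hQ2 hCM hK hne3 hne4 hHN hsur in
omit [(W.baseChange K).IsElliptic] in
/-- `KolyvaginRelationAtTwo` with the datum of conductor `m l` given at a conductor `N = m l`
(through the cast `subst`). [cite: McCallumLMS1991, §4 Prop. 4.4] [cite: GrossLMS1991, Prop. 3.7, Prop. 6.2] -/
theorem kolyvaginRelationAtTwo_cast (M : ℕ) (hM : 1 ≤ M) {m l N : ℕ} (hN : m * l = N)
    (hsq : Squarefree N) (hl : l.Prime) (hlm : ¬ l ∣ m)
    (hK' : ∀ l' ∈ N.primeFactors, Zhang2014.IsKolyvaginPrime (W.conductorNorm ℤ) W K 2 l' ∧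
      M ≤ Zhang2014.kolyvaginIndex W 2 l')
    (d : KolyvaginHeegnerData Dt β ι m) (d' : KolyvaginHeegnerData Dt β ι N)
    (hσ : ∀ l' ∈ m.primeFactors, ∀ (x : ringClassField K ι m) (x' : ringClassField K ι N),
      (x : ℂ) = x' → ((d'.σ l' x' : ringClassField K ι N) : ℂ) = (d.σ l' x : ℂ))
    (hS : ∀ s ∈ d.S, ∃ s' ∈ d'.S, ∀ (x : ringClassField K ι m) (x' : ringClassField K ι N),
      (x : ℂ) = x' → ((s' x' : ringClassField K ι N) : ℂ) = (s x : ℂ))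
    (hS' : ∀ s' ∈ d'.S, ∃ s ∈ d.S, ∀ (x : ringClassField K ι m) (x' : ringClassField K ι N),
      (x : ℂ) = x' → ((s' x' : ringClassField K ι N) : ℂ) = (s x : ℂ))
    (hemb : ∀ (x : ringClassField K ι m) (x' : ringClassField K ι N), (x : ℂ) = x' → d'.emb x' = d.emb x)
    (v : HeightOneSpectrum (𝓞 K)) (hv : ((l : ℕ) : 𝓞 K) ∈ v.asIdeal) (j : ℕ) :
    (((2 ^ j : ℕ) : ℤ) • d'.kolyvaginClass Nat.prime_two M ∈
        selmerLocalKer (W.baseChange K) (v.adicCompletion K) ((2 ^ M : ℕ) : ℤ) ↔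
      ((2 ^ j : ℕ) : ℤ) • d'.kolyvaginClass Nat.prime_two M ∈
        (W.baseChange K).torsionLocalKer (v.adicCompletion K) ((2 ^ M : ℕ) : ℤ)) ∧
    (((2 ^ j : ℕ) : ℤ) • d'.kolyvaginClass Nat.prime_two M ∈
        (W.baseChange K).torsionLocalKer (v.adicCompletion K) ((2 ^ M : ℕ) : ℤ) ↔
      ((2 ^ j : ℕ) : ℤ) • d.kolyvaginClass Nat.prime_two M ∈
        (W.baseChange K).torsionLocalKer (v.adicCompletion K) ((2 ^ M : ℕ) : ℤ)) := by
  subst hN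
  exact hQ2 W hCM K hK hne3 hne4 hHN hsur Dt β ι M hM m l hsq hl hlm hK' d d' hσ hS hS' hemb v hv j

end Frame

end Summit.BirchSwinnertonDyer.BirchSwinnertonDyer.Theorems.KolyvaginLowerBoundAtTwo

end
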